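import Summits.KontsevichZagierPeriods.KontsevichZagierPeriods.Theorems.SoloInformedDomCalculus
import Summits.KontsevichZagierPeriods.KontsevichZagierPeriods.Theorems.SoloInformedCellLeaf
import Summits.KontsevichZagierPeriods.KontsevichZagierPeriods.Theorems.SoloInformedLocalSide
import HarnessLib

/-!
# Cell branches: a real branch of a `K`-curve across the unit square, and the band leaves

Solo programme `solo-KontsevichZagierPeriods-informed`, session s110, PRES-RAT(2) step (β)-2.

A **cell branch** is the unit-square normal form of the local picture at a smooth point of the
boundary curve: a `K`-polynomial `H`, a complex-analytic implicit branch `A` (real on reals) on a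
neighbourhood of `[0,1]`, and the SIGN description of `H` on the closed square — `H > 0` exactly
above the graph of `a = Re A` and `H < 0` exactly below it.  Unlike a unit branch
(`SoloInformedUnitBranch`) the graph may leave the square through the bottom or top edge.

Over a `K`-interval `[α, α + β] ⊆ [0,1]` on whose interior the branch stays inside `(0,1)`,
rescaling `x = α + β x'` produces a unit branch (`SoloInformedCellBranch.rescale`); transporting
the CELL LEAVES (`SoloInformedUnitBranch.presentable_upper/lower`) back along the scale move
(rule (2), `soloInformed_presOn_image`) gives the **band leaves**: a `K`-rational function whose
denominator does not vanish on the closed square is presentable on the parts of the slab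
`(α, α + β) × (0, 1)` above and below the graph.  The **slab leaf** (the full slab) is THEOREM 2D⁺
transported along the same scale move.

References: M. Kontsevich, D. Zagier, *Periods* (2001) §1.2.
-/

noncomputable section

open scoped BigOperators Topology
open MeasureTheory Set Metric
open Literature.NumberTheory.Transcendental Literature.NumberTheory.Transcendental.KZ
open Literature.ModelTheory.ExponentialFields (IsSemialgebraic)

namespace Summit.KontsevichZagierPeriods.KontsevichZagierPeriods.Theorems

variable {n : ℕ} {K : Type*} [Field K] [Algebra K ℝ]

/-! ### Substitutions: injectivity and complex evaluation -/

omit [Algebra K ℝ] in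
/-- The scale substitution `Λ_{i,a,b}` has the left inverse `Λ_{i,-a/b,1/b}`. -/
theorem soloInformed_scaleSubstK_comp_inv (i : Fin n) (a b : K) (hb : b ≠ 0) :
    (soloInformedScaleSubstK i (-a / b) b⁻¹).comp (soloInformedScaleSubstK i a b) =
      AlgHom.id K (MvPolynomial (Fin n) K) := by
  apply MvPolynomial.algHom_ext
  intro j
  simp only [AlgHom.comp_apply, AlgHom.id_apply, soloInformedScaleSubstK,
    MvPolynomial.bind₁_X_right]
  by_cases hj : j = i
  · simp only [hj, if_true, map_add, map_mul, MvPolynomial.bind₁_C_right,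
      MvPolynomial.bind₁_X_right]
    rw [mul_add, ← mul_assoc, ← map_mul, ← map_mul, ← add_assoc, ← map_add,
      mul_inv_cancel₀ hb, map_one, one_mul,
      show a + b * (-a / b) = 0 by field_simp; ring, map_zero, zero_add]
  · simp [hj]

omit [Algebra K ℝ] in
/-- The scale substitution with `b ≠ 0` is injective. -/
theorem soloInformed_scaleSubstK_injective (i : Fin n) (a b : K) (hb : b ≠ 0) :
    Function.Injective (soloInformedScaleSubstK i a b) := by
  refine Function.LeftInverse.injective (g := soloInformedScaleSubstK i (-a / b) b⁻¹) fun p => ?_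
  rw [← AlgHom.comp_apply, soloInformed_scaleSubstK_comp_inv i a b hb, AlgHom.id_apply]

omit [Algebra K ℝ] in
/-- Complex evaluation of a `bind₁` substitution. -/
theorem soloInformed_evalC_bind₁ (f : K →+* ℂ) (g : Fin 2 → MvPolynomial (Fin 2) K)
    (H : MvPolynomial (Fin 2) K) (z w : ℂ) :
    soloInformedEvalC f (MvPolynomial.bind₁ g H) z w =
      MvPolynomial.eval₂ f (fun i => soloInformedEvalC f (g i) z w) H := by
  unfold soloInformedEvalC
  have h := MvPolynomial.eval₂Hom_bind₁ f ![z, w] g H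
  simpa only [MvPolynomial.coe_eval₂Hom] using h

omit [Algebra K ℝ] in
/-- Complex evaluation of the scale substitution in the first variable:
`(Λ_{0,a,b} H)^f(z, w) = H^f(f a + f b · z, w)`. -/
theorem soloInformed_evalC_scaleSubstK_zero (f : K →+* ℂ) (a b : K)
    (H : MvPolynomial (Fin 2) K) (z w : ℂ) :
    soloInformedEvalC f (soloInformedScaleSubstK 0 a b H) z w =
      soloInformedEvalC f H (f a + f b * z) w := by
  unfold soloInformedScaleSubstK
  rw [soloInformed_evalC_bind₁]
  unfold soloInformedEvalC
  congr 1
  funext i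
  fin_cases i
  · simp
  · simp

/-- The scale move in the first variable on pairs. -/
theorem soloInformed_scaleMoveR_zero_vec2 (α β s t : ℝ) :
    soloInformedScaleMoveR 0 α β ![s, t] = ![α + β * s, t] := by
  funext i
  fin_cases i
  · simp [soloInformedScaleMoveR]
  · simp [soloInformedScaleMoveR]

/-- For `0 ≤ α`, `0 < β`, `α + β ≤ 1` the scale move in the first variable maps the closed cube
into itself. -/
theorem soloInformed_scaleMoveR_zero_mem_cube {α β : ℝ} (hα : 0 ≤ α) (hβ : 0 < β)
    (hαβ : α + β ≤ 1) {y : Fin n → ℝ} (hy : y ∈ soloInformedCube n) (i : Fin n) :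
    soloInformedScaleMoveR i α β y ∈ soloInformedCube n := by
  intro j
  by_cases hj : j = i
  · rw [hj, soloInformed_scaleMoveR_apply_self]
    have h1 := (hy i).1
    have h2 := (hy i).2
    constructor
    · positivity
    · nlinarith
  · rw [soloInformed_scaleMoveR_apply_ne i α β y hj]
    exact hy j

/-! ### The affine reparametrisation of the complex line -/

/-- `z ↦ α + β z` on `ℂ`, real parameters. [this work] -/
def soloInformedAffC (α β : ℝ) (z : ℂ) : ℂ := (α : ℂ) + (β : ℂ) * z

/-- Real points go to real points. -/
theorem soloInformed_affC_ofReal (α β s : ℝ) :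
    soloInformedAffC α β (s : ℂ) = ((α + β * s : ℝ) : ℂ) := by
  simp only [soloInformedAffC]
  push_cast
  ring

/-- The affine reparametrisation is continuous. -/
theorem soloInformed_continuous_affC (α β : ℝ) : Continuous (soloInformedAffC α β) := by
  unfold soloInformedAffC
  fun_prop

/-- The affine reparametrisation is entire. -/
theorem soloInformed_analyticOnNhd_affC (α β : ℝ) (U : Set ℂ) :
    AnalyticOnNhd ℂ (soloInformedAffC α β) U := fun z _ => by
  unfold soloInformedAffC
  exact analyticAt_const.add (analyticAt_const.mul analyticAt_id)

/-- `α + β·[0,1] ⊆ [0,1]` for `0 ≤ α`, `0 < β`, `α + β ≤ 1`. -/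
theorem soloInformed_affine_mem_Icc {α β : ℝ} (hα : 0 ≤ α) (hβ : 0 < β) (hαβ : α + β ≤ 1)
    {x : ℝ} (hx : x ∈ Icc (0 : ℝ) 1) : α + β * x ∈ Icc (0 : ℝ) 1 :=
  ⟨by nlinarith [hx.1], by nlinarith [hx.2]⟩

/-! ### Cell branches -/

/-- **Cell branch data.**  A `K`-polynomial `H`, a complex branch `A` analytic and real on reals
on an open `V ⊇ [0,1]` with `H(z, A z) = 0`, such that on the closed unit square `H > 0` exactly
above the graph of `Re A` and `H < 0` exactly below it. [this work] -/
structure SoloInformedCellBranch (K : Type*) [Field K] [Algebra K ℝ] where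
  /-- the branch polynomial -/
  H : MvPolynomial (Fin 2) K
  /-- the complex branch -/
  A : ℂ → ℂ
  /-- a complex neighbourhood of `[0,1]` -/
  V : Set ℂ
  /-- `V` is open -/
  isOpen_V : IsOpen V
  /-- `V ⊇ [0,1]` -/
  mem_V : ∀ x : ℝ, x ∈ Icc (0 : ℝ) 1 → (x : ℂ) ∈ V
  /-- `A` is analytic on `V` -/
  analyticA : AnalyticOnNhd ℂ A V
  /-- `A` is real on real points -/
  realA : ∀ x : ℝ, (x : ℂ) ∈ V → (A x).im = 0
  /-- `H(z, A z) = 0` on `V` -/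
  zero : ∀ z ∈ V, soloInformedEvalC (soloInformedKToC K) H z (A z) = 0
  /-- on the closed square, `H > 0` exactly above the graph -/
  pos_iff : ∀ s t : ℝ, s ∈ Icc (0 : ℝ) 1 → t ∈ Icc (0 : ℝ) 1 →
    (0 < (MvPolynomial.aeval ![s, t] H : ℝ) ↔ (A s).re < t)
  /-- on the closed square, `H < 0` exactly below the graph -/
  neg_iff : ∀ s t : ℝ, s ∈ Icc (0 : ℝ) 1 → t ∈ Icc (0 : ℝ) 1 →
    ((MvPolynomial.aeval ![s, t] H : ℝ) < 0 ↔ t < (A s).re)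

namespace SoloInformedCellBranch

/-- The real branch `a = Re A`. [this work] -/
def a (γ : SoloInformedCellBranch K) (s : ℝ) : ℝ := (γ.A s).re

/-- At a real point of `V`, `A = a`. -/
theorem A_ofReal (γ : SoloInformedCellBranch K) {s : ℝ} (hs : (s : ℂ) ∈ γ.V) :
    γ.A s = (γ.a s : ℂ) :=
  Complex.ext (by simp [a]) (by simpa [a] using γ.realA s hs)

/-- `a` is continuous on `[0,1]`. -/
theorem continuousOn_a (γ : SoloInformedCellBranch K) : ContinuousOn γ.a (Icc 0 1) := by
  have h1 : ContinuousOn (fun s : ℝ => γ.A s) (Icc 0 1) :=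
    γ.analyticA.continuousOn.comp Complex.continuous_ofReal.continuousOn fun s hs => γ.mem_V s hs
  exact Complex.continuous_re.comp_continuousOn h1

/-- In the closed square, `H = 0` exactly on the graph of `a`. -/
theorem aeval_eq_zero_iff (γ : SoloInformedCellBranch K) {s t : ℝ} (hs : s ∈ Icc (0 : ℝ) 1)
    (ht : t ∈ Icc (0 : ℝ) 1) : (MvPolynomial.aeval ![s, t] γ.H : ℝ) = 0 ↔ t = γ.a s := by
  constructor
  · intro h
    rcases lt_trichotomy t (γ.a s) with hlt | heq | hgt
    · have := (γ.neg_iff s t hs ht).2 hlt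
      rw [h] at this
      exact absurd this (lt_irrefl 0)
    · exact heq
    · have := (γ.pos_iff s t hs ht).2 hgt
      rw [h] at this
      exact absurd this (lt_irrefl 0)
  · intro h
    have hV : ((s : ℝ) : ℂ) ∈ γ.V := γ.mem_V s hs
    have h0 := γ.zero _ hV
    have hpt : soloInformedToC 2 ![s, t] = ![((s : ℝ) : ℂ), γ.A s] := by
      funext i
      fin_cases i
      · simp [soloInformedToC_apply]
      · simp [soloInformedToC_apply, h, γ.A_ofReal hV]
    unfold soloInformedEvalC at h0
    rw [← hpt, ← soloInformed_ofReal_aevalK] at h0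
    exact_mod_cast h0

/-- The branch polynomial is nonzero. -/
theorem H_ne (γ : SoloInformedCellBranch K) : γ.H ≠ 0 := by
  intro h
  have h0 := γ.pos_iff 0 1 ⟨le_rfl, zero_le_one⟩ ⟨zero_le_one, le_rfl⟩
  have h1 := γ.neg_iff 0 0 ⟨le_rfl, zero_le_one⟩ ⟨le_rfl, zero_le_one⟩
  rw [h, map_zero] at h0 h1
  simp only [lt_self_iff_false, false_iff, not_lt] at h0 h1
  linarith

/-- Sign description at a point of the closed square: `H > 0` iff above the graph. -/
theorem pos_iff' (γ : SoloInformedCellBranch K) {z : Fin 2 → ℝ} (hz : z ∈ soloInformedCube 2) :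
    0 < (MvPolynomial.aeval z γ.H : ℝ) ↔ γ.a (z 0) < z 1 := by
  have hz' : (![z 0, z 1] : Fin 2 → ℝ) = z := by funext i; fin_cases i <;> rfl
  rw [← hz']
  exact γ.pos_iff (z 0) (z 1) (hz 0) (hz 1)

/-- Sign description at a point of the closed square: `H < 0` iff below the graph. -/
theorem neg_iff' (γ : SoloInformedCellBranch K) {z : Fin 2 → ℝ} (hz : z ∈ soloInformedCube 2) :
    (MvPolynomial.aeval z γ.H : ℝ) < 0 ↔ z 1 < γ.a (z 0) := by
  have hz' : (![z 0, z 1] : Fin 2 → ℝ) = z := by funext i; fin_cases i <;> rfl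
  rw [← hz']
  exact γ.neg_iff (z 0) (z 1) (hz 0) (hz 1)

/-- `H = 0` at a point of the closed square iff the point lies on the graph. -/
theorem aeval_eq_zero_iff' (γ : SoloInformedCellBranch K) {z : Fin 2 → ℝ}
    (hz : z ∈ soloInformedCube 2) : (MvPolynomial.aeval z γ.H : ℝ) = 0 ↔ z 1 = γ.a (z 0) := by
  have hz' : (![z 0, z 1] : Fin 2 → ℝ) = z := by funext i; fin_cases i <;> rfl
  rw [← hz']
  exact γ.aeval_eq_zero_iff (hz 0) (hz 1)

/-- **The part of a `ℚ`-semialgebraic `W ⊆ [0,1]²` above the graph is `ℚ`-semialgebraic**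
(`= W ∩ {H > 0}`). -/
theorem isSemialgebraic_above (γ : SoloInformedCellBranch K)
    (hK : ∀ c : K, IsAlgebraic ℚ (algebraMap K ℝ c)) {W : Set (Fin 2 → ℝ)}
    (hW : IsSemialgebraic ℚ W) (hWc : W ⊆ soloInformedCube 2) :
    IsSemialgebraic ℚ {z | z ∈ W ∧ γ.a (z 0) < z 1} := by
  have h := (soloInformed_isSemialgebraicFunOn_aevalK hK hW (-γ.H)).isSemialgebraic_sep_neg
  convert h using 1
  ext z
  simp only [mem_setOf_eq, map_neg, neg_lt_zero]
  constructor
  · rintro ⟨hz, h⟩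
    exact ⟨hz, (γ.pos_iff' (hWc hz)).2 h⟩
  · rintro ⟨hz, h⟩
    exact ⟨hz, (γ.pos_iff' (hWc hz)).1 h⟩

/-- **The part of a `ℚ`-semialgebraic `W ⊆ [0,1]²` below the graph is `ℚ`-semialgebraic**
(`= W ∩ {H < 0}`). -/
theorem isSemialgebraic_below (γ : SoloInformedCellBranch K)
    (hK : ∀ c : K, IsAlgebraic ℚ (algebraMap K ℝ c)) {W : Set (Fin 2 → ℝ)}
    (hW : IsSemialgebraic ℚ W) (hWc : W ⊆ soloInformedCube 2) :
    IsSemialgebraic ℚ {z | z ∈ W ∧ z 1 < γ.a (z 0)} := by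
  have h := (soloInformed_isSemialgebraicFunOn_aevalK hK hW γ.H).isSemialgebraic_sep_neg
  convert h using 1
  ext z
  simp only [mem_setOf_eq]
  constructor
  · rintro ⟨hz, h⟩
    exact ⟨hz, (γ.neg_iff' (hWc hz)).2 h⟩
  · rintro ⟨hz, h⟩
    exact ⟨hz, (γ.neg_iff' (hWc hz)).1 h⟩

/-! ### Rescaling over a `K`-interval to a unit branch -/

section Rescale

variable (γ : SoloInformedCellBranch K) (a0 b0 : K)
  (hα : 0 ≤ algebraMap K ℝ a0) (hβ : 0 < algebraMap K ℝ b0)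
  (hαβ : algebraMap K ℝ a0 + algebraMap K ℝ b0 ≤ 1)
  (hin : ∀ s : ℝ, 0 < s → s < 1 →
    0 < γ.a (algebraMap K ℝ a0 + algebraMap K ℝ b0 * s) ∧
      γ.a (algebraMap K ℝ a0 + algebraMap K ℝ b0 * s) < 1)

/-- **Rescaling a cell branch** over the `K`-interval `[α, α + β] ⊆ [0,1]` (`α = a0`, `β = b0`),
on whose interior the branch stays inside `(0,1)`, to a unit branch: `H' = Λ_{0,a0,b0} H`,
`A'(z) = A(α + β z)`. [this work] -/
def rescale : SoloInformedUnitBranch K where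
  H := soloInformedScaleSubstK 0 a0 b0 γ.H
  A := fun z => γ.A (soloInformedAffC (algebraMap K ℝ a0) (algebraMap K ℝ b0) z)
  V := soloInformedAffC (algebraMap K ℝ a0) (algebraMap K ℝ b0) ⁻¹' γ.V
  H_ne := fun h => γ.H_ne (soloInformed_scaleSubstK_injective 0 a0 b0
    (fun hb => by rw [hb, map_zero] at hβ; exact lt_irrefl _ hβ) (by rw [h, map_zero]))
  isOpen_V := γ.isOpen_V.preimage (soloInformed_continuous_affC _ _)
  mem_V := fun x hx => by
    show soloInformedAffC _ _ (x : ℂ) ∈ γ.V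
    rw [soloInformed_affC_ofReal]
    exact γ.mem_V _ (soloInformed_affine_mem_Icc hα hβ hαβ hx)
  analyticA := γ.analyticA.comp (soloInformed_analyticOnNhd_affC _ _ _) (mapsTo_preimage _ _)
  realA := fun x hx => by
    show (γ.A (soloInformedAffC _ _ (x : ℂ))).im = 0
    have hx' : soloInformedAffC (algebraMap K ℝ a0) (algebraMap K ℝ b0) (x : ℂ) ∈ γ.V := hx
    rw [soloInformed_affC_ofReal] at hx' ⊢
    exact γ.realA _ hx'
  zero := fun z hz => by
    show soloInformedEvalC (soloInformedKToC K) (soloInformedScaleSubstK 0 a0 b0 γ.H) z _ = 0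
    rw [soloInformed_evalC_scaleSubstK_zero]
    have h : (soloInformedKToC K a0 : ℂ) + soloInformedKToC K b0 * z =
        soloInformedAffC (algebraMap K ℝ a0) (algebraMap K ℝ b0) z := by
      simp [soloInformedAffC]
    rw [h]
    exact γ.zero _ hz
  uniq := fun s t hs0 hs1 ht0 ht1 h => by
    rw [soloInformed_aeval_scaleSubstK, soloInformed_scaleMoveR_zero_vec2] at h
    have hst := (γ.aeval_eq_zero_iff (soloInformed_affine_mem_Icc hα hβ hαβ ⟨hs0.le, hs1.le⟩)
      ⟨ht0.le, ht1.le⟩).1 h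
    rw [hst]
    show γ.a _ = (γ.A (soloInformedAffC _ _ (s : ℂ))).re
    rw [soloInformed_affC_ofReal]
    rfl
  inside := fun s hs0 hs1 => by
    show 0 < (γ.A (soloInformedAffC _ _ (s : ℂ))).re ∧ (γ.A (soloInformedAffC _ _ (s : ℂ))).re < 1
    rw [soloInformed_affC_ofReal]
    exact hin s hs0 hs1

/-- The real branch of the rescaled unit branch. -/
theorem rescale_a (s : ℝ) :
    (γ.rescale a0 b0 hα hβ hαβ hin).a s = γ.a (algebraMap K ℝ a0 + algebraMap K ℝ b0 * s) := by
  show (γ.A (soloInformedAffC _ _ (s : ℂ))).re = _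
  rw [soloInformed_affC_ofReal]
  rfl

/-- The branch polynomial of the rescaled unit branch. -/
theorem rescale_H : (γ.rescale a0 b0 hα hβ hαβ hin).H = soloInformedScaleSubstK 0 a0 b0 γ.H := rfl

end Rescale

end SoloInformedCellBranch

/-! ### The slab leaf -/

/-- **SLAB LEAF.**  Over a field `K` of real algebraic numbers all of whose polynomials are
presentable denominators, every `K`-rational function is presentable on the slab
`{x ∈ (0,1)ⁿ : α < xᵢ < α + β}` with endpoints in `K` (rule (2) along `Λ_{i,a0,b0}`, whose pulled
back form is `b0 · P(Λ x)/Q(Λ x)` on the open cube). [this work] -/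
theorem soloInformed_presOn_slabK_rational
    (hK : ∀ c : K, IsAlgebraic ℚ (algebraMap K ℝ c))
    (hall : ∀ Q : MvPolynomial (Fin n) K, SoloInformedPresentableDenK Q) (i : Fin n) (a0 b0 : K)
    (hα : 0 ≤ algebraMap K ℝ a0) (hβ : 0 < algebraMap K ℝ b0)
    (hαβ : algebraMap K ℝ a0 + algebraMap K ℝ b0 ≤ 1) (P Q : MvPolynomial (Fin n) K) :
    SoloInformedPresOn (soloInformedSlabR i (algebraMap K ℝ a0) (algebraMap K ℝ b0))
      (fun x => (MvPolynomial.aeval x P : ℝ) / MvPolynomial.aeval x Q) := by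
  rw [← soloInformed_image_scaleMoveR i hα hβ hαβ]
  have hO := isSemialgebraic_soloInformedOpenCube n
  refine soloInformed_presOn_image hO _ (fun _ => soloInformedScaleDerivR i (algebraMap K ℝ b0))
    (soloInformed_isSemialgebraicMapOn_scaleMoveK hK i a0 b0 hO)
    (fun x _ => (soloInformed_hasFDerivAt_scaleMoveR i _ _ x).hasFDerivWithinAt)
    ((soloInformed_scaleMoveR_injective i hβ.ne').injOn) ?_ ?_
  · refine (soloInformed_isSemialgebraicFunOn_aevalK hK hO (MvPolynomial.C b0)).congr fun x _ => ?_
    simp only [MvPolynomial.aeval_C, soloInformed_det_scaleDerivR, abs_of_pos hβ]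
  · intro ρ hρ hρi
    refine hall (soloInformedScaleSubstK i a0 b0 Q) (MvPolynomial.C b0 * soloInformedScaleSubstK i a0 b0 P)
      ρ (le_of_eq hρ.symm) (by rw [hρ]; exact soloInformedOpenCube_subset_cube n) fun x hx => ?_
    rw [hρi (by rw [← hρ] at hx ⊢; exact hx)]
    simp only [map_mul, MvPolynomial.aeval_C, soloInformed_aeval_scaleSubstK,
      soloInformed_det_scaleDerivR, abs_of_pos hβ]
    ring

/-- **SLAB LEAF in two variables** (THEOREM 2D⁺). [this work] -/
theorem soloInformed_presOn_slabK_rational_dim2 [CharZero K]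
    (hK : ∀ c : K, IsAlgebraic ℚ (algebraMap K ℝ c)) (hKrc : SoloInformedRealRootClosed K)
    (i : Fin 2) (a0 b0 : K) (hα : 0 ≤ algebraMap K ℝ a0) (hβ : 0 < algebraMap K ℝ b0)
    (hαβ : algebraMap K ℝ a0 + algebraMap K ℝ b0 ≤ 1) (P Q : MvPolynomial (Fin 2) K) :
    SoloInformedPresOn (soloInformedSlabR i (algebraMap K ℝ a0) (algebraMap K ℝ b0))
      (fun x => (MvPolynomial.aeval x P : ℝ) / MvPolynomial.aeval x Q) :=
  soloInformed_presOn_slabK_rational hK (soloInformed_presentableDenK_dim2_all hK hKrc) i a0 b0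
    hα hβ hαβ P Q

end Summit.KontsevichZagierPeriods.KontsevichZagierPeriods.Theorems
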